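import Literature.Probability.Percolation.Percolation
import HarnessLib

/-!
# Two-configuration swap cover for the three-cluster product row: sealing and implanting clusters

builds on p205010 (kernel theorem, internal audit signed; external expert review pending)

Support file (`--supports stmt-CriticalPhenomena-4575`), seat `prim-quant-p1` (gen 40); memo
`run/shared/lean/prim/quant/prim-quant-p1-g40/FOR-LEAD-Z32-SWAPCOVER.md`.  No definitions, no named facts, no sorries;
standard axioms.  Purely combinatorial (no measure): the statements hold for arbitrary edge sets on an arbitrary vertex type.

CONTEXT.  The three-port case of `Z(3,2)` follows (✓ p560550 `ThreePort.le_one_reached_le_of_productRow3`) from the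
product row F1: `P(a↔b↔c)·P(a|b|c) ≤ 3·P(a joined to exactly one of b,c)` at the three apexes.  The natural attack is
Gladkov's two-configuration method: for a pair of configurations `(C₁, C₂)` with `C₁ ∈ abc` (all three joined) and
`C₂ ∈ a|b|c` (pairwise separated), build a MIXTURE taking the `C₂`-value on a set `S` of edges and the `C₁`-value elsewhere,
landing in the target event; a fixed-`S` swap preserves the product measure (and pointwise weights), so a family of such maps
that is injective (decodable) proves the row with the constant = number of families.  This file proves the COMBINATORIAL
HEART, found by exhaustive search (all graphs on ≤ 6 vertices) and proved here in general:

* SEALING (`seal_reachable_iff`, `seal_reachable_iff_of_not_mem`): with `K = C_c(C₂)` the `C₂`-cluster of `c` and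
  `Y := C₂ on the edges touching K, C₁ elsewhere`, the `Y`-cluster of `c` is exactly `K`, and outside `K` the
  `Y`-connectivity is the `C₁`-connectivity in the graph with `K` deleted.  (So `Y` is decodable: `K = C_c(Y)`.)
* IMPLANTING (`implant_reachable_sub`, `implant_reachable_of_mem`, `implant_reachable_K`): with `A = ` the `C₁`-cluster of
  `a` avoiding `K` and `X := C₁ on the edges touching A, C₂ elsewhere`, the `X`-cluster of `a` is contained in `A ∪ K`,
  contains `A`, and contains all of `K` as soon as one `C₁`-open edge joins `A` to `K`.
* COVER (`swap_cover`): if `C₁ ∈ abc` and `C₂ ∈ a|b|c` then EITHER `Y ∈ ab|c` (when `b ∈ A`) OR `X ∈ ac|b` (when `b ∉ A`).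
  Hence the pair space `abc × a|b|c` is covered POINTWISE by two swap maps; the sealing map is injective, so
  `P(abc)·P(a|b|c) ≤ P(ab|c) + P(ac|b) + μ⊗μ(B)` with `B` = {both single seals fail} (measure-theoretic wrapper not in
  this file).  The remaining obstruction to F1 is the decodability of the implant map on `B` (memo §3–§5).
-/

namespace Summit.CriticalPhenomena.PercolationContinuityZ3.Theorems

open Literature.Probability.Percolation

variable {V : Type*}

namespace ThreeClusterSwap

/-- Induction along an open path with an invariant: if `P` holds at `x` and is preserved by every adjacency step of `G`
out of a `P`-vertex, then `P` holds at every vertex reachable from `x`. [this work] -/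
theorem reachable_invariant {G : SimpleGraph V} {P : V → Prop} {x v : V} (h : G.Reachable x v) (h0 : P x)
    (hstep : ∀ u w, P u → G.Adj u w → P w) : P v := by
  rw [SimpleGraph.reachable_iff_reflTransGen] at h
  induction h with
  | refl => exact h0
  | tail _ hbc ih => exact hstep _ _ ih hbc

/-- Transfer of reachability: if every `G`-step out of a `P`-vertex preserves `P` and is also a `G'`-step, then a `G`-path
from a `P`-vertex `x` is a `G'`-path. [this work] -/
theorem reachable_transfer {G G' : SimpleGraph V} {P : V → Prop} {x v : V} (h : G.Reachable x v) (h0 : P x)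
    (hstep : ∀ u w, P u → G.Adj u w → P w ∧ G'.Adj u w) : G'.Reachable x v ∧ P v := by
  rw [SimpleGraph.reachable_iff_reflTransGen] at h
  induction h with
  | refl => exact ⟨SimpleGraph.Reachable.refl x, h0⟩
  | tail _ hbc ih =>
    obtain ⟨hP, hadj⟩ := hstep _ _ ih.2 hbc
    exact ⟨ih.1.trans hadj.reachable, hP⟩

section Seal

variable (C₁ C₂ : Set (Sym2 V)) (c : V) (K : Set V) (TK Y : Set (Sym2 V))

/-- **Sealing, inside.**  Let `K` be the `C₂`-cluster of `c`, `TK` the edges touching `K`, and `Y` the mixture taking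
`C₂`-values on `TK` and `C₁`-values elsewhere.  Then the `Y`-cluster of `c` is exactly `K`. [this work] -/
theorem seal_reachable_iff (hK : K = {v | (openGraph C₂).Reachable c v}) (hTK : TK = {e | ∃ v ∈ K, v ∈ e})
    (hY : Y = (C₂ ∩ TK) ∪ (C₁ \ TK)) (v : V) :
    (openGraph Y).Reachable c v ↔ (openGraph C₂).Reachable c v := by
  -- an edge touching `K` lies in `Y` iff it lies in `C₂`
  have hagree : ∀ u w, u ∈ K → (s(u, w) ∈ Y ↔ s(u, w) ∈ C₂) := by
    intro u w hu
    have ht : s(u, w) ∈ TK := by rw [hTK]; exact ⟨u, hu, Sym2.mem_mk_left u w⟩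
    rw [hY]
    constructor
    · rintro (⟨h2, -⟩ | ⟨-, hnt⟩)
      · exact h2
      · exact (hnt ht).elim
    · intro h2; exact Or.inl ⟨h2, ht⟩
  have hcK : c ∈ K := by rw [hK]; exact SimpleGraph.Reachable.refl c
  constructor
  · intro h
    have := reachable_transfer (G' := openGraph C₂) (P := fun u => u ∈ K) h hcK (by
      intro u w hu huw
      rw [openGraph_adj] at huw
      have h2 : s(u, w) ∈ C₂ := (hagree u w hu).1 huw.1
      have hadj : (openGraph C₂).Adj u w := (openGraph_adj C₂ u w).2 ⟨h2, huw.2⟩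
      refine ⟨?_, hadj⟩
      rw [hK] at hu ⊢
      exact hu.trans hadj.reachable)
    exact this.1
  · intro h
    have := reachable_transfer (G' := openGraph Y) (P := fun u => u ∈ K) h hcK (by
      intro u w hu huw
      rw [openGraph_adj] at huw
      have hY' : s(u, w) ∈ Y := (hagree u w hu).2 huw.1
      refine ⟨?_, (openGraph_adj Y u w).2 ⟨hY', huw.2⟩⟩
      rw [hK] at hu ⊢
      exact hu.trans ((openGraph_adj C₂ u w).2 huw).reachable)
    exact this.1

/-- **Sealing, outside.**  With `K, TK, Y` as in `seal_reachable_iff`: from a vertex `u ∉ K`, the `Y`-connectivity is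
exactly the `C₁`-connectivity using only edges not touching `K` (an open path from outside `K` can never enter the
sealed cluster, whose boundary edges carry their `C₂`-values, i.e. are closed). [this work] -/
theorem seal_reachable_iff_of_not_mem (hK : K = {v | (openGraph C₂).Reachable c v})
    (hTK : TK = {e | ∃ v ∈ K, v ∈ e}) (hY : Y = (C₂ ∩ TK) ∪ (C₁ \ TK)) {u : V} (hu : u ∉ K) (v : V) :
    (openGraph Y).Reachable u v ↔ (openGraph (C₁ \ TK)).Reachable u v := by
  constructor
  · intro h
    have := reachable_transfer (G' := openGraph (C₁ \ TK)) (P := fun x => x ∉ K) h hu (by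
      intro x w hx hxw
      rw [openGraph_adj] at hxw
      obtain ⟨hxwY, hne⟩ := hxw
      -- the edge cannot touch `K`
      have hnt : s(x, w) ∉ TK := by
        intro ht
        have h2 : s(x, w) ∈ C₂ := by
          rw [hY] at hxwY
          rcases hxwY with ⟨h2, -⟩ | ⟨-, hnt⟩
          · exact h2
          · exact (hnt ht).elim
        rw [hTK] at ht
        obtain ⟨z, hzK, hz⟩ := ht
        rcases Sym2.mem_iff.1 hz with rfl | rfl
        · exact hx hzK
        · -- `w ∈ K` and the edge is `C₂`-open, so `x ∈ K`
          apply hx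
          rw [hK] at hzK ⊢
          exact hzK.trans ((openGraph_adj C₂ z x).2 ⟨by rw [Sym2.eq_swap]; exact h2, hne.symm⟩).reachable
      have h1 : s(x, w) ∈ C₁ \ TK := by
        rw [hY] at hxwY
        rcases hxwY with ⟨-, ht⟩ | h1
        · exact (hnt ht).elim
        · exact h1
      refine ⟨?_, (openGraph_adj _ x w).2 ⟨h1, hne⟩⟩
      intro hwK
      exact hnt (by rw [hTK]; exact ⟨w, hwK, Sym2.mem_mk_right x w⟩))
    exact this.1
  · intro h
    -- monotonicity `C₁ \ TK ⊆ Y` (cf. `UnifDim.reachable_openGraph_mono`; inlined to keep the imports minimal)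
    refine (reachable_transfer (G' := openGraph Y) (P := fun _ => True) h trivial ?_).1
    intro x w _ hxw
    rw [openGraph_adj] at hxw ⊢
    refine ⟨trivial, ?_, hxw.2⟩
    rw [hY]; exact Or.inr hxw.1

end Seal

section Implant

variable (C₁ C₂ : Set (Sym2 V)) (a c : V) (K A : Set V) (TK TA X : Set (Sym2 V))

/-- The `C₁`-cluster of `a` avoiding `K` does not meet `K` (when `a ∉ K`). [this work] -/
theorem avoid_disjoint (hTK : TK = {e | ∃ v ∈ K, v ∈ e})
    (hA : A = {v | (openGraph (C₁ \ TK)).Reachable a v}) (ha : a ∉ K) {v : V} (hv : v ∈ A) : v ∉ K := by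
  rw [hA] at hv
  exact reachable_invariant (P := fun x => x ∉ K) hv ha (by
    intro u w _ huw hwK
    rw [openGraph_adj] at huw
    exact huw.1.2 (by rw [hTK]; exact ⟨w, hwK, Sym2.mem_mk_right u w⟩))

/-- **Implanting, upper bound.**  Let `K` be the `C₂`-cluster of `c` (with `a ∉ K`), `A` the `C₁`-cluster of `a` avoiding
`K`, `TA` the edges touching `A`, and `X` the mixture taking `C₁`-values on `TA` and `C₂`-values elsewhere.  Then the
`X`-cluster of `a` is contained in `A ∪ K`. [this work] -/
theorem implant_reachable_sub (hK : K = {v | (openGraph C₂).Reachable c v}) (hTK : TK = {e | ∃ v ∈ K, v ∈ e})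
    (hA : A = {v | (openGraph (C₁ \ TK)).Reachable a v}) (hTA : TA = {e | ∃ v ∈ A, v ∈ e})
    (hX : X = (C₁ ∩ TA) ∪ (C₂ \ TA)) (ha : a ∉ K) {v : V} (hv : (openGraph X).Reachable a v) : v ∈ A ∨ v ∈ K := by
  have haA : a ∈ A := by rw [hA]; exact SimpleGraph.Reachable.refl a
  refine reachable_invariant (P := fun x => x ∈ A ∨ x ∈ K) hv (Or.inl haA) ?_
  intro u w hu huw
  rw [openGraph_adj] at huw
  obtain ⟨huwX, hne⟩ := huw
  rw [hX] at huwX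
  rcases hu with huA | huK
  · -- the edge touches `A`, hence carries its `C₁`-value
    have ht : s(u, w) ∈ TA := by rw [hTA]; exact ⟨u, huA, Sym2.mem_mk_left u w⟩
    have h1 : s(u, w) ∈ C₁ := by
      rcases huwX with ⟨h1, -⟩ | ⟨-, hnt⟩
      · exact h1
      · exact (hnt ht).elim
    by_cases hwK : w ∈ K
    · exact Or.inr hwK
    · left
      have huK : u ∉ K := avoid_disjoint C₁ a K A TK hTK hA ha huA
      have hnt : s(u, w) ∉ TK := by
        rw [hTK]; rintro ⟨z, hzK, hz⟩
        rcases Sym2.mem_iff.1 hz with rfl | rfl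
        · exact huK hzK
        · exact hwK hzK
      rw [hA] at huA ⊢
      exact huA.trans ((openGraph_adj (C₁ \ TK) u w).2 ⟨⟨h1, hnt⟩, hne⟩).reachable
  · by_cases hwA : w ∈ A
    · exact Or.inl hwA
    · -- the edge does not touch `A` (else `w ∈ A` or `u ∈ A`, but `u ∈ K` is not in `A`), hence carries its `C₂`-value
      have huA : u ∉ A := fun huA => avoid_disjoint C₁ a K A TK hTK hA ha huA huK
      have hnt : s(u, w) ∉ TA := by
        rw [hTA]; rintro ⟨z, hzA, hz⟩
        rcases Sym2.mem_iff.1 hz with rfl | rfl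
        · exact huA hzA
        · exact hwA hzA
      have h2 : s(u, w) ∈ C₂ := by
        rcases huwX with ⟨-, ht⟩ | ⟨h2, -⟩
        · exact (hnt ht).elim
        · exact h2
      right
      rw [hK] at huK ⊢
      exact huK.trans ((openGraph_adj C₂ u w).2 ⟨h2, hne⟩).reachable

/-- **Implanting, the `a`-side.**  With the notation of `implant_reachable_sub`: every vertex of `A` is in the `X`-cluster
of `a`. [this work] -/
theorem implant_reachable_of_mem
    (hA : A = {v | (openGraph (C₁ \ TK)).Reachable a v}) (hTA : TA = {e | ∃ v ∈ A, v ∈ e})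
    (hX : X = (C₁ ∩ TA) ∪ (C₂ \ TA)) {v : V} (hv : v ∈ A) : (openGraph X).Reachable a v := by
  have haA : a ∈ A := by rw [hA]; exact SimpleGraph.Reachable.refl a
  have hv' : (openGraph (C₁ \ TK)).Reachable a v := by rw [hA] at hv; exact hv
  refine (reachable_transfer (G' := openGraph X) (P := fun x => x ∈ A) hv' haA ?_).1
  intro u w hu huw
  rw [openGraph_adj] at huw
  have hwA : w ∈ A := by
    rw [hA] at hu ⊢; exact hu.trans ((openGraph_adj _ u w).2 huw).reachable
  refine ⟨hwA, (openGraph_adj X u w).2 ⟨?_, huw.2⟩⟩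
  rw [hX]; left
  exact ⟨huw.1.1, by rw [hTA]; exact ⟨u, hu, Sym2.mem_mk_left u w⟩⟩

/-- **Implanting, the `K`-side.**  With the notation of `implant_reachable_sub`: if some `C₁`-open edge joins a vertex
`x ∈ A` to a vertex `y ∈ K` (a DOOR), then the whole of `K` is in the `X`-cluster of `a` (enter through the door, then
use the `C₂`-open edges of `K`, none of which touches `A`). [this work] -/
theorem implant_reachable_K (hK : K = {v | (openGraph C₂).Reachable c v}) (hTK : TK = {e | ∃ v ∈ K, v ∈ e})
    (hA : A = {v | (openGraph (C₁ \ TK)).Reachable a v}) (hTA : TA = {e | ∃ v ∈ A, v ∈ e})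
    (hX : X = (C₁ ∩ TA) ∪ (C₂ \ TA)) (ha : a ∉ K) {x y : V} (hx : x ∈ A) (hy : y ∈ K) (hxy : s(x, y) ∈ C₁)
    (hne : x ≠ y) {v : V} (hv : v ∈ K) : (openGraph X).Reachable a v := by
  -- reach `x`, step through the door to `y`
  have hax : (openGraph X).Reachable a x := implant_reachable_of_mem C₁ C₂ a A TK TA X hA hTA hX hx
  have hxyX : (openGraph X).Adj x y := by
    rw [openGraph_adj]; refine ⟨?_, hne⟩
    rw [hX]; left; exact ⟨hxy, by rw [hTA]; exact ⟨x, hx, Sym2.mem_mk_left x y⟩⟩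
  have hay : (openGraph X).Reachable a y := hax.trans hxyX.reachable
  -- inside `K`, `C₂`-open edges do not touch `A`
  have hyv : (openGraph C₂).Reachable y v := by
    have hcy : (openGraph C₂).Reachable c y := by rw [hK] at hy; exact hy
    have hcv : (openGraph C₂).Reachable c v := by rw [hK] at hv; exact hv
    exact hcy.symm.trans hcv
  have := reachable_transfer (G' := openGraph X) (P := fun u => u ∈ K) hyv hy (by
    intro u w hu huw
    rw [openGraph_adj] at huw
    have hwK : w ∈ K := by rw [hK] at hu ⊢; exact hu.trans ((openGraph_adj C₂ u w).2 huw).reachable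
    have huA : u ∉ A := fun huA => avoid_disjoint C₁ a K A TK hTK hA ha huA hu
    have hwA : w ∉ A := fun hwA => avoid_disjoint C₁ a K A TK hTK hA ha hwA hwK
    have hnt : s(u, w) ∉ TA := by
      rw [hTA]; rintro ⟨z, hzA, hz⟩
      rcases Sym2.mem_iff.1 hz with rfl | rfl
      · exact huA hzA
      · exact hwA hzA
    refine ⟨hwK, (openGraph_adj X u w).2 ⟨?_, huw.2⟩⟩
    rw [hX]; right; exact ⟨huw.1, hnt⟩)
  exact hay.trans this.1

end Implant

section Cover

variable (C₁ C₂ : Set (Sym2 V)) (a b c : V) (K A : Set V) (TK TA X Y : Set (Sym2 V))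

/-- **The two-map swap cover of `abc × a|b|c`.**  Let `C₁` join `a` to `c` (in the application also to `b`), and let `C₂`
separate `c` from `a` and from `b` (in the application `a, b, c` pairwise).  Let `K = C_c(C₂)`, `TK` = edges touching `K`, `Y = C₂ on TK, C₁ elsewhere` (seal `c`), `A` = the `C₁`-cluster
of `a` avoiding `K`, `TA` = edges touching `A`, `X = C₁ on TA, C₂ elsewhere` (implant `A`).  Then either `Y ∈ ab|c`
(`a ↔ b`, `a ↮ c` in `Y`) — exactly when `b ∈ A` — or `X ∈ ac|b` (`a ↔ c`, `a ↮ b` in `X`).  [this work] -/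
theorem swap_cover (hK : K = {v | (openGraph C₂).Reachable c v}) (hTK : TK = {e | ∃ v ∈ K, v ∈ e})
    (hY : Y = (C₂ ∩ TK) ∪ (C₁ \ TK)) (hA : A = {v | (openGraph (C₁ \ TK)).Reachable a v})
    (hTA : TA = {e | ∃ v ∈ A, v ∈ e}) (hX : X = (C₁ ∩ TA) ∪ (C₂ \ TA))
    (hac₁ : (openGraph C₁).Reachable a c)
    (hac₂ : ¬ (openGraph C₂).Reachable a c) (hbc₂ : ¬ (openGraph C₂).Reachable b c) :
    ((openGraph Y).Reachable a b ∧ ¬ (openGraph Y).Reachable a c) ∨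
      ((openGraph X).Reachable a c ∧ ¬ (openGraph X).Reachable a b) := by
  have haK : a ∉ K := by rw [hK]; exact fun h => hac₂ h.symm
  have hbK : b ∉ K := by rw [hK]; exact fun h => hbc₂ h.symm
  have hcK : c ∈ K := by rw [hK]; exact SimpleGraph.Reachable.refl c
  by_cases hbA : b ∈ A
  · left
    refine ⟨?_, ?_⟩
    · rw [seal_reachable_iff_of_not_mem C₁ C₂ c K TK Y hK hTK hY haK]
      rw [hA] at hbA; exact hbA
    · intro h
      rw [seal_reachable_iff_of_not_mem C₁ C₂ c K TK Y hK hTK hY haK] at h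
      have hcA : c ∈ A := by rw [hA]; exact h
      exact avoid_disjoint C₁ a K A TK hTK hA haK hcA hcK
  · right
    refine ⟨?_, ?_⟩
    · -- a door exists: the first edge of a `C₁`-path from `a` to `c` leaving `A` lands in `K`
      have haA : a ∈ A := by rw [hA]; exact SimpleGraph.Reachable.refl a
      have hcA : c ∉ A := fun hcA => avoid_disjoint C₁ a K A TK hTK hA haK hcA hcK
      obtain ⟨p⟩ := hac₁
      obtain ⟨d, -, hd1, hd2⟩ := p.exists_boundary_dart A haA hcA
      have hadj := d.adj
      rw [openGraph_adj] at hadj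
      have hyK : d.toProd.2 ∈ K := by
        by_contra hyK
        have hxK : d.toProd.1 ∉ K := avoid_disjoint C₁ a K A TK hTK hA haK hd1
        have hnt : s(d.toProd.1, d.toProd.2) ∉ TK := by
          rw [hTK]; rintro ⟨z, hzK, hz⟩
          rcases Sym2.mem_iff.1 hz with h | h
          · exact hxK (h ▸ hzK)
          · exact hyK (h ▸ hzK)
        apply hd2
        rw [hA] at hd1 ⊢
        exact hd1.trans ((openGraph_adj (C₁ \ TK) d.toProd.1 d.toProd.2).2 ⟨⟨hadj.1, hnt⟩, hadj.2⟩).reachable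
      exact implant_reachable_K C₁ C₂ a c K A TK TA X hK hTK hA hTA hX haK hd1 hyK hadj.1 hadj.2 hcK
    · intro h
      rcases implant_reachable_sub C₁ C₂ a c K A TK TA X hK hTK hA hTA hX haK h with hbA' | hbK'
      · exact hbA hbA'
      · exact hbK hbK'

/-- **Decodability of the sealing map.**  In the first case of `swap_cover` the output `Y` determines the swapped set: the
`Y`-cluster of `c` is `K = C_c(C₂)` (restated from `seal_reachable_iff` in cluster form). [this work] -/
theorem seal_cluster_eq (hK : K = {v | (openGraph C₂).Reachable c v}) (hTK : TK = {e | ∃ v ∈ K, v ∈ e})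
    (hY : Y = (C₂ ∩ TK) ∪ (C₁ \ TK)) : {v | (openGraph Y).Reachable c v} = K := by
  ext v
  rw [hK]
  exact seal_reachable_iff C₁ C₂ c K TK Y hK hTK hY v

/-- **The implant output is sealed as a whole.**  In the second case of `swap_cover` (a door exists), the `X`-cluster of
`a` is exactly `A ∪ K`; what is NOT determined by `X` is the splitting of this cluster into `A` and `K` — the decoding
problem of the memo. [this work] -/
theorem implant_cluster_eq (hK : K = {v | (openGraph C₂).Reachable c v}) (hTK : TK = {e | ∃ v ∈ K, v ∈ e})
    (hA : A = {v | (openGraph (C₁ \ TK)).Reachable a v}) (hTA : TA = {e | ∃ v ∈ A, v ∈ e})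
    (hX : X = (C₁ ∩ TA) ∪ (C₂ \ TA)) (ha : a ∉ K) {x y : V} (hx : x ∈ A) (hy : y ∈ K) (hxy : s(x, y) ∈ C₁)
    (hne : x ≠ y) : {v | (openGraph X).Reachable a v} = A ∪ K := by
  ext v
  constructor
  · intro hv
    exact implant_reachable_sub C₁ C₂ a c K A TK TA X hK hTK hA hTA hX ha hv
  · rintro (hvA | hvK)
    · exact implant_reachable_of_mem C₁ C₂ a A TK TA X hA hTA hX hvA
    · exact implant_reachable_K C₁ C₂ a c K A TK TA X hK hTK hA hTA hX ha hx hy hxy hne hvK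

end Cover

end ThreeClusterSwap

end Summit.CriticalPhenomena.PercolationContinuityZ3.Theorems
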